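import Mathlib
import Summits.KontsevichZagierPeriods.Zeta5Search.CatalanTwoAdicForm
import Summits.KontsevichZagierPeriods.Zeta5Search.CatalanTwoAdicAtoms
import Summits.KontsevichZagierPeriods.Zeta5Search.Denom.CatalanRayPClosed
import HarnessLib

/-!
# CatalanTwoAdicPF — the 2-adic transfer of the slid Catalan-ray forms, reduced to a FINITE partial-fraction identity

HONEST FRAMING: systematic search; no irrationality claim unless certified.  `G` irrational is NOT claimed;
`ξ = ζ₂(2) ∉ ℚ` is KNOWN (Calegari 2005).

fam-catalan (pub-zeta5), `families/catalan/TWOADIC.md` §12, step T-A2 of the INTRINSIC 2-adic ray chain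
(`CatalanTwoAdicRay.ray_measure_intrinsic`, `CatalanTwoAdicRayBound.xi_not_ratCast_intrinsic`): those theorems take
ANY rational sequence `P_n` with the 2-adic identity `J₂(n, jn, n, (j+1)n, n) = P_n + ξ·Q_n`; the intended `P_n` is
fam-denom's EXPLICIT closed form `Denom.CatalanRayPClosed.rayPClosed j n` (whose integrality `rayPClosed_isInt` is
fam-denom D9).  This file proves that 2-adic identity MODULO ONE FINITE IDENTITY OF RATIONAL FUNCTIONS, the
partial-fraction decomposition `PF n J` of
`R_n(T) = (½)_n · Π_{i<J+n}(T − J + ½ + i) / (Π_{0≤i≤J}(T − J + n + i) · Π_{e<2n}(T + e + 1))`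
at the half-integers `T = ν + ½` with fam-denom's pole coefficients `coef` / `logDer` (CATK6 §1; poles
`T = c ∈ [0, J−n]` simple, `T = −a`, `1 ≤ a ≤ n` double, `n < a ≤ 2n` simple):

* `jTerm_ray_eq` : the `ν`-th term of the tree's defining series of `J₂(n, J, n, J+n, n)` (`CatalanTwoAdicForm.jTerm`)
  is `t_{ν+J} · R_n(ν + J + ½)` — the SLIDE of the expansion point (pure finite-product algebra: `t_{m+k} = t_m ·
  Π_{i<k}(m+i+1)/(m+i+3/2)`, `C(ν+J, J)·J! = Π_{i<J}(ν+1+i)`), and `R_n(ν′ + ½) = 0` for `ν′ < J`; hence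
  `hasSum_slidTerm : Σ^{(2)}_{ν′ ≥ 0} t_{ν′} R_n(ν′ + ½) = J₂(n, J, n, J+n, n)`.
* `J2_eq_of_PF` : **`PF n J → J₂(n, J, n, J+n, n) = PClosed n J + ξ · QxiClosed n J` in `ℚ₂`**, where `PClosed` is
  fam-denom's definition BY NAME and `QxiClosed n J = Σ_c coef(c)·8C(2c,c)4^{−c} − 8 Σ_{a=1}^{n} coef(−a)·t_{a−1}`
  (the `ξ`-coefficient produced by the same decomposition).  Inputs BY NAME: the 2-adic atom identities
  `CatalanTwoAdicAtoms.S1_nat / S1_neg / S2_nat` (CATK1 Lemma S with `G ↦ ξ`) and linearity of `HasSum`.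
* `J2_ray_eq_of_PF` : on the ray `J = jn`, with the identification `QxiClosed n (jn) = catalanQ(n, jn, n, (j+1)n, n)`
  as a second finite hypothesis, exactly hypothesis (a) of `ray_measure_intrinsic` for `P := rayPClosed j`.

* `J2_ray_three_one` : the UNCONDITIONAL kernel instance `n = 1` of ray `3`: `PF 1 3` (`PF_one_three`, by clearing
  denominators), `QxiClosed 1 3 = 1971/256 = catalanQ(1,3,1,4,1)` (kernel evaluations), hence
  **`J₂(1,3,1,4,1) = rayPClosed 3 1 + ξ·catalanQ(1,3,1,4,1)` in `ℚ₂`** — the first kernel-certified instance of the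
  2-adic transfer law (F13a / K5a(ii)) for a Catalan box form.

NOT proved here: `PF n J` itself (an identity of rational functions in `ν` for symbolic `(n, J)`: residues at simple
poles = Lagrange interpolation; the double poles need the logarithmic-derivative companions `logDer`) and the
identification `QxiClosed = catalanQ` on rays.  Both were CHECKED in exact rational arithmetic outside Lean
(`PF`: all `n ≤ 3`, `n ≤ J ≤ 4n+1`, `ν ≤ 11` and generic `T`; `QxiClosed = QClosed(n,J,n,J+n,n)`: all `n ≤ 4`,
`n ≤ J ≤ 5n`; 0 mismatches) — a check, not a proof.
-/

namespace Summit.KontsevichZagierPeriods.Zeta5Search.CatalanTwoAdicSeries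

open Finset Filter Topology
open Summit.KontsevichZagierPeriods.Zeta5Search.Denom.CatalanRayAtoms
open Summit.KontsevichZagierPeriods.Zeta5Search.Denom.CatalanRayPClosed
  (K0 Nnum coef logDer termA termBB termBA termG PClosed rayPClosed D1 D2 skip)
open Summit.KontsevichZagierPeriods.Zeta5Search.CatalanQSum (catalanQ)

/-! ### Finite products -/

/-- `(x+½)_N` as a `Finset` product. -/
theorem halfPoch_eq_prod (x : ℤ) : ∀ N : ℕ, halfPoch x N = ∏ i ∈ range N, ((x : ℚ) + i + 1 / 2)
  | 0 => by simp [halfPoch]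
  | N + 1 => by rw [halfPoch, halfPoch_eq_prod x N, prod_range_succ]

/-- Iterated `tB_succ`: `t_{m+k} = t_m · Π_{i<k} (m+i+1)/(m+i+3/2)`. -/
theorem tB_add_eq (m : ℕ) : ∀ k : ℕ,
    tB (m + k) = tB m * ((∏ i ∈ range k, ((m : ℚ) + i + 1)) / ∏ i ∈ range k, ((m : ℚ) + i + 3 / 2))
  | 0 => by simp
  | k + 1 => by
    rw [← add_assoc, tB_succ, tB_add_eq m k, prod_range_succ, prod_range_succ]
    have h1 : (2 * ((m + k : ℕ) : ℚ) + 3) ≠ 0 := by positivity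
    have h2 : ∏ i ∈ range k, ((m : ℚ) + i + 3 / 2) ≠ 0 := prod_ne_zero_iff.mpr fun i _ => by positivity
    have h3 : ((m : ℚ) + k + 3 / 2) ≠ 0 := by positivity
    push_cast
    field_simp
    ring

/-- `C(ν+J, J)·J! = Π_{i<J}(ν+1+i)` (the ascending factorial). -/
theorem choose_mul_factorial_eq_prod (ν J : ℕ) :
    ((Nat.choose (ν + J) J : ℕ) : ℚ) * (J.factorial : ℚ) = ∏ i ∈ range J, ((ν : ℚ) + i + 1) := by
  have h1 := Nat.ascFactorial_eq_factorial_mul_choose ν J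
  have h2 := Nat.ascFactorial_eq_prod_range (ν + 1) J
  have h3 : ((Nat.choose (ν + J) J : ℕ) : ℚ) * (J.factorial : ℚ) = (((ν + 1).ascFactorial J : ℕ) : ℚ) := by
    rw [h1]; push_cast; ring
  rw [h3, h2]
  push_cast
  exact prod_congr rfl fun i _ => by ring

/-! ### The rational function `R_n` and the slide -/

/-- The first denominator family `Π_{0≤i≤J}(T − J + n + i)` (no factor skipped). -/
def Dfull1 (n J : ℕ) (T : ℚ) : ℚ := ∏ i ∈ range (J + 1), (T - J + n + i)

/-- The second denominator family `Π_{e<2n}(T + e + 1)` (no factor skipped). -/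
def Dfull2 (n : ℕ) (T : ℚ) : ℚ := ∏ e ∈ range (2 * n), (T + e + 1)

/-- `R_n(T) = (½)_n · N(T) / (Π_{0≤i≤J}(T − J + n + i) · Π_{e<2n}(T + e + 1))` with fam-denom's `K0`, `Nnum`. -/
def Rn (n J : ℕ) (T : ℚ) : ℚ := K0 n * Nnum n J T / (Dfull1 n J T * Dfull2 n T)

/-- `R_n(ν + ½) = 0` for `ν < J` (the numerator factor `i = J − 1 − ν` vanishes): the slide is free. -/
theorem Rn_half_eq_zero (n J ν : ℕ) (h : ν < J) : Rn n J ((ν : ℚ) + 1 / 2) = 0 := by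
  obtain ⟨d, rfl⟩ : ∃ d, J = ν + 1 + d := ⟨J - ν - 1, by omega⟩
  unfold Rn Nnum
  rw [prod_eq_zero (i := d) (mem_range.mpr (by omega)) (by push_cast; ring), mul_zero, zero_div]

/-- **The slide.** The `ν`-th term of the defining series of `J₂(n, J, n, J+n, n)` is `t_{ν+J} · R_n(ν + J + ½)`. -/
theorem jTerm_ray_eq (n J ν : ℕ) :
    jTerm n J n (J + n) n ν = tB (ν + J) * Rn n J ((ν : ℚ) + J + 1 / 2) := by
  have ht : tB (J + n + ν) = tB (ν + J) * ((∏ i ∈ range n, ((ν : ℚ) + J + i + 1)) /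
      ∏ i ∈ range n, ((ν : ℚ) + J + i + 3 / 2)) := by
    rw [show J + n + ν = (ν + J) + n by ring, tB_add_eq]
    push_cast
    rfl
  have hCJ : ((Nat.choose (ν + (J + n - n)) (J + n - n) : ℕ) : ℚ) * (J.factorial : ℚ) =
      ∏ i ∈ range J, ((ν : ℚ) + i + 1) := by
    rw [Nat.add_sub_cancel, choose_mul_factorial_eq_prod]
  have hK : halfPoch 0 n = ∏ i ∈ range n, ((i : ℚ) + 1 / 2) := by
    rw [halfPoch_eq_prod]; push_cast; exact prod_congr rfl fun i _ => by ring
  have hD : halfPoch ((ν : ℤ) + n) (J + 1) = ∏ i ∈ range (J + 1), ((ν : ℚ) + n + i + 1 / 2) := by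
    rw [halfPoch_eq_prod]; push_cast; rfl
  have hE : halfPoch (((J + n : ℕ) : ℤ) + ν + 1) n = ∏ i ∈ range n, ((ν : ℚ) + J + n + i + 3 / 2) := by
    rw [halfPoch_eq_prod]; push_cast; exact prod_congr rfl fun i _ => by ring
  have hK0 : K0 n = ∏ i ∈ range n, ((i : ℚ) + 1 / 2) := by
    unfold K0; exact prod_congr rfl fun i _ => by ring
  have hN : Nnum n J ((ν : ℚ) + J + 1 / 2) =
      (∏ i ∈ range J, ((ν : ℚ) + i + 1)) * ∏ i ∈ range n, ((ν : ℚ) + J + i + 1) := by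
    unfold Nnum; rw [prod_range_add]; push_cast
    exact congrArg₂ (· * ·) (prod_congr rfl fun i _ => by ring) (prod_congr rfl fun i _ => by ring)
  have hD1 : Dfull1 n J ((ν : ℚ) + J + 1 / 2) = ∏ i ∈ range (J + 1), ((ν : ℚ) + n + i + 1 / 2) := by
    unfold Dfull1; exact prod_congr rfl fun i _ => by ring
  have hD2 : Dfull2 n ((ν : ℚ) + J + 1 / 2) =
      (∏ i ∈ range n, ((ν : ℚ) + J + i + 3 / 2)) * ∏ i ∈ range n, ((ν : ℚ) + J + n + i + 3 / 2) := by
    unfold Dfull2; rw [two_mul, prod_range_add]; push_cast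
    exact congrArg₂ (· * ·) (prod_congr rfl fun i _ => by ring) (prod_congr rfl fun i _ => by ring)
  unfold jTerm Rn
  rw [ht, mul_assoc (tB (ν + J) * _) , hCJ, hK, hD, hE, hK0, hN, hD1, hD2]
  ring

/-- The `ν`-th term of the SLID series: `t_ν · R_n(ν + ½)`. -/
def slidTerm (n J ν : ℕ) : ℚ := tB ν * Rn n J ((ν : ℚ) + 1 / 2)

/-- The first `J` slid terms vanish. -/
theorem slidTerm_eq_zero (n J ν : ℕ) (h : ν < J) : slidTerm n J ν = 0 := by
  rw [slidTerm, Rn_half_eq_zero n J ν h, mul_zero]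

/-- The defining series, re-indexed: `jTerm(ν) = slidTerm(ν + J)`. -/
theorem jTerm_eq_slidTerm (n J ν : ℕ) : jTerm n J n (J + n) n ν = slidTerm n J (ν + J) := by
  rw [jTerm_ray_eq, slidTerm]; push_cast; rfl

/-- **`J₂(n, J, n, J+n, n) = Σ^{(2)}_{ν ≥ 0} t_ν R_n(ν + ½)`** (the slid series, summed 2-adically from `ν = 0`). -/
theorem hasSum_slidTerm (n J : ℕ) :
    HasSum (fun ν => ((slidTerm n J ν : ℚ) : ℚ_[2])) (J2 n J n (J + n) n) := by
  have h1 : HasSum (fun ν => ((jTerm n J n (J + n) n ν : ℚ) : ℚ_[2])) (J2 n J n (J + n) n) :=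
    (summable_jTerm _ _ _ _ _).hasSum
  have h0 : ∑ i ∈ range J, ((slidTerm n J i : ℚ) : ℚ_[2]) = 0 :=
    sum_eq_zero fun i hi => by rw [slidTerm_eq_zero n J i (mem_range.mp hi)]; push_cast; rfl
  have h2 : HasSum (fun ν => ((slidTerm n J (ν + J) : ℚ) : ℚ_[2]))
      (J2 n J n (J + n) n - ∑ i ∈ range J, ((slidTerm n J i : ℚ) : ℚ_[2])) := by
    rw [h0, sub_zero]; simpa only [jTerm_eq_slidTerm] using h1
  exact (hasSum_nat_add_iff' J).mp h2

/-! ### The partial-fraction hypothesis and the kernels -/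

/-- **The finite partial-fraction identity `PF n J`** (CATK6 §1) for `R_n` at the half-integers, with fam-denom's
pole coefficients: `R_n(ν+½) = Σ_{c=0}^{J−n} coef(c)/(ν+½−c) + Σ_{a=1}^{n} [coef(−a)/(ν+½+a)² +
coef(−a)·logDer(−a)/(ν+½+a)] + Σ_{a=n+1}^{2n} coef(−a)/(ν+½+a)`.  An identity of rational functions in `ν`;
NOT proved in this file for symbolic `(n, J)` (hypothesis of `J2_eq_of_PF`; the instance `PF 1 3` is `PF_one_three`). -/
@[conjecture] def PF (n J : ℕ) : Prop :=
  ∀ ν : ℕ, Rn n J ((ν : ℚ) + 1 / 2) =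
    (∑ c ∈ range (J - n + 1), coef n J c / ((ν : ℚ) + 1 / 2 - c))
      + (∑ a ∈ Icc 1 n, (coef n J (-(a : ℚ)) / ((ν : ℚ) + 1 / 2 + a) ^ 2
          + coef n J (-(a : ℚ)) * logDer n J (-(a : ℚ)) / ((ν : ℚ) + 1 / 2 + a)))
      + ∑ a ∈ Icc (n + 1) (2 * n), coef n J (-(a : ℚ)) / ((ν : ℚ) + 1 / 2 + a)

/-- simple-pole kernel: `t_ν · A/(ν+½+a) = A · s1Term a ν`. -/
theorem tB_mul_div_eq (a : ℤ) (ν : ℕ) (A : ℚ) :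
    tB ν * (A / ((ν : ℚ) + 1 / 2 + a)) = A * s1Term a ν := by
  unfold s1Term
  have h := oddDen_ne_zero a ν
  have h' : ((ν : ℚ) + 1 / 2 + a) ≠ 0 := fun h0 => h (by linarith)
  field_simp
  ring

/-- double-pole kernel: `t_ν · A/(ν+½+a)² = A · s2Term a ν`. -/
theorem tB_mul_div_sq_eq (a : ℤ) (ν : ℕ) (A : ℚ) :
    tB ν * (A / ((ν : ℚ) + 1 / 2 + a) ^ 2) = A * s2Term a ν := by
  unfold s2Term
  have h := oddDen_ne_zero a ν
  have h' : ((ν : ℚ) + 1 / 2 + a) ≠ 0 := fun h0 => h (by linarith)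
  field_simp
  ring

/-- Under `PF`, each slid term is a finite combination of the atom kernels `s1Term` / `s2Term`. -/
theorem slidTerm_eq_of_PF {n J : ℕ} (hPF : PF n J) (ν : ℕ) :
    slidTerm n J ν =
      (∑ c ∈ range (J - n + 1), coef n J c * s1Term (-(c : ℤ)) ν)
        + (∑ a ∈ Icc 1 n, (coef n J (-(a : ℚ)) * s2Term a ν
            + coef n J (-(a : ℚ)) * logDer n J (-(a : ℚ)) * s1Term a ν))
        + ∑ a ∈ Icc (n + 1) (2 * n), coef n J (-(a : ℚ)) * s1Term a ν := by
  rw [slidTerm, hPF ν, mul_add, mul_add, mul_sum, mul_sum, mul_sum]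
  refine congrArg₂ (· + ·) (congrArg₂ (· + ·) ?_ ?_) ?_
  · refine sum_congr rfl fun c _ => ?_
    have h := tB_mul_div_eq (-(c : ℤ)) ν (coef n J c)
    push_cast at h
    rw [← sub_eq_add_neg] at h
    exact h
  · refine sum_congr rfl fun a _ => ?_
    have h1 := tB_mul_div_sq_eq a ν (coef n J (-(a : ℚ)))
    have h2 := tB_mul_div_eq a ν (coef n J (-(a : ℚ)) * logDer n J (-(a : ℚ)))
    push_cast at h1 h2
    rw [mul_add, h1, h2]
  · refine sum_congr rfl fun a _ => ?_
    have h := tB_mul_div_eq a ν (coef n J (-(a : ℚ)))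
    push_cast at h
    exact h

/-- Under `PF`, the slid series sums 2-adically to the corresponding finite combination of the atoms `S₁`, `S₂`. -/
theorem hasSum_slidTerm_of_PF {n J : ℕ} (hPF : PF n J) :
    HasSum (fun ν => ((slidTerm n J ν : ℚ) : ℚ_[2]))
      ((∑ c ∈ range (J - n + 1), ((coef n J c : ℚ) : ℚ_[2]) * S1 (-(c : ℤ)))
        + (∑ a ∈ Icc 1 n, (((coef n J (-(a : ℚ)) : ℚ) : ℚ_[2]) * S2 a
            + ((coef n J (-(a : ℚ)) * logDer n J (-(a : ℚ)) : ℚ) : ℚ_[2]) * S1 a))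
        + ∑ a ∈ Icc (n + 1) (2 * n), ((coef n J (-(a : ℚ)) : ℚ) : ℚ_[2]) * S1 a) := by
  have key : (fun ν => ((slidTerm n J ν : ℚ) : ℚ_[2])) = fun ν =>
      (∑ c ∈ range (J - n + 1), ((coef n J c : ℚ) : ℚ_[2]) * ((s1Term (-(c : ℤ)) ν : ℚ) : ℚ_[2]))
        + (∑ a ∈ Icc 1 n, (((coef n J (-(a : ℚ)) : ℚ) : ℚ_[2]) * ((s2Term a ν : ℚ) : ℚ_[2])
            + ((coef n J (-(a : ℚ)) * logDer n J (-(a : ℚ)) : ℚ) : ℚ_[2]) * ((s1Term a ν : ℚ) : ℚ_[2])))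
        + ∑ a ∈ Icc (n + 1) (2 * n), ((coef n J (-(a : ℚ)) : ℚ) : ℚ_[2]) * ((s1Term a ν : ℚ) : ℚ_[2]) := by
    funext ν
    rw [slidTerm_eq_of_PF hPF ν]
    push_cast
    rfl
  rw [key]
  refine HasSum.add (HasSum.add ?_ ?_) ?_
  · exact hasSum_sum fun c _ => (hasSum_S1 _).mul_left _
  · exact hasSum_sum fun a _ => ((hasSum_S2 _).mul_left _).add ((hasSum_S1 _).mul_left _)
  · exact hasSum_sum fun a _ => (hasSum_S1 _).mul_left _

/-! ### Assembly: `J₂ = PClosed + ξ · QxiClosed` -/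

/-- fam-denom's `t_{a−1}` is the tree's `tB (a − 1)` (`a ≥ 1`). -/
theorem tB_denom_eq (a : ℕ) (ha : 1 ≤ a) : Denom.CatalanRayPClosed.tB a = tB (a - 1) := by
  unfold Denom.CatalanRayPClosed.tB tB
  rw [show 2 * (a - 1) + 1 = 2 * a - 1 by omega]

/-- **The `ξ`-coefficient produced by the partial-fraction decomposition**:
`Σ_{c=0}^{J−n} coef(c)·8C(2c,c)4^{−c} − 8 Σ_{a=1}^{n} coef(−a)·t_{a−1}` (conjecturally `= catalanQ(n, J, n, J+n, n)`;
checked in exact arithmetic, not proved here). -/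
def QxiClosed (n J : ℕ) : ℚ :=
  (∑ c ∈ range (J - n + 1), coef n J c * (8 * (Nat.choose (2 * c) c : ℚ) / 4 ^ c))
    - 8 * ∑ a ∈ Icc 1 n, coef n J (-(a : ℚ)) * Denom.CatalanRayPClosed.tB a

/-- **T-A2 modulo `PF`.**  `PF n J → J₂(n, J, n, J+n, n) = PClosed n J + ξ · QxiClosed n J` in `ℚ₂`, with fam-denom's
explicit rational part `PClosed` BY NAME. -/
theorem J2_eq_of_PF (n J : ℕ) (hPF : PF n J) :
    J2 n J n (J + n) n = ((PClosed n J : ℚ) : ℚ_[2]) + xi * ((QxiClosed n J : ℚ) : ℚ_[2]) := by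
  rw [(hasSum_slidTerm n J).unique (hasSum_slidTerm_of_PF hPF)]
  have eA : ∑ c ∈ range (J - n + 1), ((coef n J c : ℚ) : ℚ_[2]) * S1 (-(c : ℤ)) =
      (∑ c ∈ range (J - n + 1), ((termA n J c : ℚ) : ℚ_[2]))
        + xi * ∑ c ∈ range (J - n + 1), ((coef n J c * (8 * (Nat.choose (2 * c) c : ℚ) / 4 ^ c) : ℚ) : ℚ_[2]) := by
    rw [mul_sum, ← sum_add_distrib]
    refine sum_congr rfl fun c _ => ?_
    rw [S1_neg]; unfold termA; push_cast; ring
  have eB : ∑ a ∈ Icc 1 n, (((coef n J (-(a : ℚ)) : ℚ) : ℚ_[2]) * S2 a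
        + ((coef n J (-(a : ℚ)) * logDer n J (-(a : ℚ)) : ℚ) : ℚ_[2]) * S1 a) =
      (∑ a ∈ Icc 1 n, ((termBB n J a + termBA n J a : ℚ) : ℚ_[2]))
        - xi * (8 * ∑ a ∈ Icc 1 n, ((coef n J (-(a : ℚ)) * Denom.CatalanRayPClosed.tB a : ℚ) : ℚ_[2])) := by
    rw [mul_sum, mul_sum, ← sum_sub_distrib]
    refine sum_congr rfl fun a ha => ?_
    have ha1 : 1 ≤ a := (mem_Icc.mp ha).1
    rw [S2_nat a ha1, S1_nat a ha1]; unfold termBB termBA; rw [tB_denom_eq a ha1]; push_cast; ring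
  have eG : ∑ a ∈ Icc (n + 1) (2 * n), ((coef n J (-(a : ℚ)) : ℚ) : ℚ_[2]) * S1 a =
      ∑ a ∈ Icc (n + 1) (2 * n), ((termG n J a : ℚ) : ℚ_[2]) := by
    refine sum_congr rfl fun a ha => ?_
    have ha1 : 1 ≤ a := by have := (mem_Icc.mp ha).1; omega
    rw [S1_nat a ha1]; unfold termG; rw [tB_denom_eq a ha1]; push_cast; ring
  rw [eA, eB, eG]
  unfold PClosed QxiClosed
  push_cast
  ring

/-- **The ray form.**  On the ray `J = jn`: `PF n (jn)` and the finite identification `QxiClosed n (jn) = catalanQ(n,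
jn, n, (j+1)n, n)` give exactly hypothesis (a) of `CatalanTwoAdicRay.ray_measure_intrinsic` for `P := rayPClosed j`. -/
theorem J2_ray_eq_of_PF (j n : ℕ) (hPF : PF n (j * n))
    (hQ : QxiClosed n (j * n) = catalanQ n (j * n) n ((j + 1) * n) n) :
    J2 n (j * n) n ((j + 1) * n) n =
      ((rayPClosed j n : ℚ) : ℚ_[2]) + xi * ((catalanQ n (j * n) n ((j + 1) * n) n : ℚ) : ℚ_[2]) := by
  rw [← hQ, show (j + 1) * n = j * n + n by ring, J2_eq_of_PF n (j * n) hPF]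
  rfl

/-! ### Kernel instance: the ray `j = 3` at `n = 1` (unconditional) -/

/-- The pole coefficients of `R_1` for `J = 3` (`= shiftrep`): `A_0, A_1, A_2 = −15/128, −3/128, −5/768`,
`B_1 = −35/64`, `A_2^{γ} = −315/256`, `Λ_1 = −529/210`. -/
theorem coef_one_three_values :
    coef 1 3 0 = -15 / 128 ∧ coef 1 3 1 = -3 / 128 ∧ coef 1 3 2 = -5 / 768 ∧
      coef 1 3 (-1) = -35 / 64 ∧ coef 1 3 (-2) = -315 / 256 ∧ logDer 1 3 (-1) = -529 / 210 := by
  norm_num [coef, K0, Nnum, D1, D2, skip, logDer, prod_range_succ, sum_range_succ]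

/-- **`PF 1 3` holds** (kernel): the partial-fraction identity for `R_1`, `J = 3`, at every half-integer `ν + ½` —
an in-kernel certificate that the hypothesis `PF` is stated correctly (signs, index ranges, the `logDer` companion). -/
theorem PF_one_three : PF 1 3 := by
  intro ν
  obtain ⟨c0, c1, c2, cm1, cm2, ld⟩ := coef_one_three_values
  simp only [Rn, K0, Nnum, Dfull1, Dfull2, prod_range_succ, prod_range_zero, sum_range_succ, sum_range_zero,
    show (3 - 1 + 1 : ℕ) = 3 from rfl, show (2 * 1 : ℕ) = 2 from rfl, show Icc (1 : ℕ) 1 = {1} from rfl,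
    show Icc (1 + 1 : ℕ) 2 = {2} from rfl, sum_singleton, Nat.cast_zero, Nat.cast_one, Nat.cast_ofNat, c0, c1, c2]
  rw [cm1, cm2, ld]
  generalize hx : (ν : ℚ) + 1 / 2 = x
  have hxν : x = ν + 1 / 2 := hx.symm
  have k0 : x ≠ 0 := by rw [hxν]; positivity
  have k1 : x - 1 ≠ 0 := by
    rw [hxν]; intro h
    have h' : (2 * ν : ℤ) = 1 := by exact_mod_cast (by linarith : (2 : ℚ) * ν = 1)
    omega
  have k2 : x - 2 ≠ 0 := by
    rw [hxν]; intro h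
    have h' : (2 * ν : ℤ) = 3 := by exact_mod_cast (by linarith : (2 : ℚ) * ν = 3)
    omega
  have k3 : x + 1 ≠ 0 := by rw [hxν]; positivity
  have k4 : x + 2 ≠ 0 := by rw [hxν]; positivity
  have e1 : x - 3 + 1 + 0 = x - 2 := by ring
  have e2 : x - 3 + 1 + 1 = x - 1 := by ring
  have e3 : x - 3 + 1 + 2 = x := by ring
  have e4 : x - 3 + 1 + 3 = x + 1 := by ring
  have e5 : x + 0 + 1 = x + 1 := by ring
  have e6 : x + 1 + 1 = x + 2 := by ring
  have e7 : x - 0 = x := by ring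
  simp only [e1, e2, e3, e4, e5, e6, e7, one_mul]
  field_simp
  ring

/-- `QxiClosed 1 3 = 1971/256` (kernel evaluation). -/
theorem QxiClosed_one_three : QxiClosed 1 3 = 1971 / 256 := by
  norm_num [QxiClosed, coef, K0, Nnum, D1, D2, skip, Denom.CatalanRayPClosed.tB, prod_range_succ, sum_range_succ,
    Nat.choose_succ_succ, Nat.factorial, show Icc (1 : ℕ) 1 = {1} from rfl]

/-- `catalanQ(1,3,1,4,1) = 1971/256` (kernel evaluation of the tree's `catalanQ`): `QxiClosed 1 3 = Q_1` on ray 3. -/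
theorem catalanQ_one_three : catalanQ 1 3 1 4 1 = 1971 / 256 := by
  decide +kernel

/-- **First kernel-certified instance of the 2-adic transfer** (ray `j = 3`, `n = 1`; UNCONDITIONAL):
`J₂(1,3,1,4,1) = rayPClosed 3 1 + ξ · catalanQ(1,3,1,4,1)` in `ℚ₂`, i.e. `= −32297/4608 + (1971/256)·ξ`
(`Denom.CatalanRayPClosed.PClosed_one_three`).  The real form is `Jsym(1,3,1,4,1) = (1971/256)·G + P_1` with the same
rational pair (fam-catalan data; the identification of `P_1` with `PClosed 1 3` is fam-denom's kernel sanity value). -/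
theorem J2_ray_three_one :
    J2 1 3 1 4 1 = ((rayPClosed 3 1 : ℚ) : ℚ_[2]) + xi * ((catalanQ 1 3 1 4 1 : ℚ) : ℚ_[2]) :=
  J2_ray_eq_of_PF 3 1 PF_one_three (QxiClosed_one_three.trans catalanQ_one_three.symm)

end Summit.KontsevichZagierPeriods.Zeta5Search.CatalanTwoAdicSeries
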